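import Summits.QuantumFields.BalabanUV.T4Continuum.Support.NE7CornerBumpFlatLHCI
import HarnessLib

/-!
# NE7CornerBumpFlatProjection — THE ORTHOGONAL PROJECTION ONTO THE SPAN OF THE BUMP CLASS'S GENERATORS AT THE FLAT BACKGROUND, EXPLICIT: a skew periodic field
# `hsR`-orthogonal to the bump class `T^ρ` IS `Φ_{LLρ}C₁ + Φ_ρ C₂` with the block formulas `γ•C₁ = S_f` off the corner class of `0`, `γ′•C₂ = S′_f` on it; plus
# the flat rigidity helpers (`Δ_1²h = 0 ⇒ Δ_1h = 0`, `Δ_1h = 0 ⇒ h` constant); file 28 (the engine of F90's `hUniq` and of the Galerkin sup letter for the bump class)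

Cell `pub-balaban`, rung (B)+1 sub-cell t4, lineage `b2b-balaban-t4-ne7-p1` (CRUX PROVER NE7 #1 = OWNER of row NE7), generation 78; memo
`t4/b2b-balaban-t4-ne7-p1-g78/BUMP-CLASS-FLAT.md` §3.  File F97 (over F95 `NE7ProfileFieldFlat`, F96 `NE7CornerBumpFlatLHCI`, row NE3's flat dictionary
`FlatBlockHarmonicInverse.sum_hsR_covLapSite_comm`, `LandauProjectionB8.sum_nhsNormSq_gaugeDir_eq`, `PeriodicChoice.periodic_vec`).
WHY (memo §3).  The bump class `T^ρ_1` (F96: clause (i) `ν ⊥ Δ_1²(Φ_ρ C)` for coarse data `C` vanishing on the corner class of `0`, clause (ii) `ν ⊥ Φ_ρ C′` for data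
supported on it) is the annihilator of the span `𝒦` of these generators, and at `W = 1` the generators are BLOCK-ORTHOGONAL profile fields (`Δ_1²(Φ_ρ C) = Φ_{LLρ}C`
by F95, margin 3), so the orthogonal projection onto `𝒦` is a FORMULA and «`f ⊥ T^ρ ⇒ f ∈ 𝒦`» (the double orthocomplement) is proved by hand: with
`S(w) := Σ_r LLρ(r)•f(M•w + r − s)`, `S′(w) := Σ_r ρ(r)•f(M•w + r − s)`, `γ := Σ_r LLρ(r)²`, `γ′ := Σ_r ρ(r)²`, `C₁ := γ⁻¹S` off the class, `C₂ := γ′⁻¹S′` on it,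
the residual `ν := f − Φ_{LLρ}C₁ − Φ_ρC₂` lies in `T^ρ` (block pairings), is orthogonal to `f` (hypothesis) and to the two profile fields (the clauses for `ν`
itself), hence `Σ‖ν‖² = 0`.  Consumers: F98 (`hUniq` at flat: `f = Δ_1²μ`), the flat Galerkin sup letter (`f = Δ_1 g`).
WHAT ([folklore]; 0 def, 0 sorry; profile∕shift∕class by equational hypotheses as in F96).  §1 helpers: `eq_smul_ediv_of_dvd`, `eq_zero_of_mem_periodBox_of_dvd`,
`dvd_add_period_iff`, `lapRho_boundaryFree`, `sum_rho_pos`, `covLapSite_flatCfg_mem_skew`, **`covLapSite_flatCfg_eq_zero_of_sq`** (`Δ_1²h = 0 ⇒ Δ_1h = 0`),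
**`const_of_covLapSite_flatCfg_eq_zero`** (`Δ_1h = 0 ⇒ h v = h 0`); §2 **`bump_projection_flatCfg`** — the explicit projection (`M ≥ 8`, `N ≥ 1`).
HONEST FRAMING (page 1): lattice linear algebra at the TRIVIAL background; nothing of Bałaban's asserted; (APE) NOT proved; NOT ONE-STEP, NOT NE7; spine 0∕9; finite T⁴
rung (B)+1 — NOT infinite volume, NOT mass gap, NOT `BetaPertH`, NOT Clay.  Continuum YM on T⁴ ⇐ BetaPertH ∧ nine spine estimates (0/9 proved); BetaPertH ⇐ (D1) ∧
(D4) ∧ CAP+tail; G-an2-4 gates asym, D1 and NE2/3/4.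
-/

set_option autoImplicit false

open scoped BigOperators Matrix Matrix.Norms.L2Operator
open NormedSpace Finset

namespace Summit.QuantumFields.BalabanUV.T4Continuum.NE7CornerBumpFlatProjection

open Literature.MathematicalPhysics.QuantumFieldTheory.Balaban1983to89
open B7Prop1Explicit B7Prop2Explicit MatrixNorms
open T4AveragingDeficitWall (IsUnitaryCfg)
open T4AveragingDeficitWallBoundary (IsPeriodicCfg periodBox mem_periodBox)
open MinimalActionWitness (flatCfg isPeriodicCfg_flatCfg)
open BlockAveragePushDirGauge (gaugeDir isPeriodicDir_gaugeDir)
open SmoothRefineBlocks (blk res)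
open NE3CovariantCalculus (hsR hsR_self hsR_add_left hsR_add_right hsR_sub_left hsR_sub_right hsR_sum_left hsR_sum_right)
open NE3FrameFreeDecompositionPrep (hsR_smul_left hsR_smul_right)
open NE3LandauOrbit (hsR_zero_left hsR_zero_right eq_zero_of_nhsNormSq_eq_zero gaugeDir_skew)
open NE3CurvedCornerGaugeSpace (covDiv_mem_skewAdjoint)
open NE3FrameFreeSliceUnique (gaugeDir_flatCfg_eq_neg_dPot)
open NE3TangentNoGoWords (dPot)
open NE3FlatHessianCurl (isUnitaryCfg_flatCfg)
open NE3.PairLandauB8 (covLapSite)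
open NE3.LandauProjectionB8 (covDiv_gaugeDir_eq_covLapSite covLapSite_add_period sum_nhsNormSq_gaugeDir_eq)
open NE3.LandauCorrectionSupB8FlatUnit (sum_covLapSite_flatCfg_eq_zero)
open NE3.FlatBlockHarmonicInverse (sum_hsR_covLapSite_comm)
open PeriodicChoice (apply_wrap_eq wrap_mem_periodBox periodic_vec)
open NE7PinnedLandauLettersOfLHCI (covLapSite_sub' covLapSite_add')
open NE7ProfileFieldFlat (profS_add_period profS_mem_skew profS_corner covLapSite_flatCfg_profS sum_hsR_profS sum_hsR_profS_profS)
open NE7CornerBumpFlatLHCI (rho_nonneg rho_support rho_boundaryFree rho_mid_pos corner_datum_class_zero)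

noncomputable section

variable {d : ℕ}

/-! ## §1 Helpers: the corner class of `0`, the Laplacian of the bump, positivity of `Σρ`, skewness of `Δ_1` -/

/-- A coarse site all of whose coordinates are divisible by `N` is `N•(w∕N)`. [folklore] -/
theorem eq_smul_ediv_of_dvd {N : ℕ} {w : Site d} (hw : ∀ i, (N : ℤ) ∣ w i) : w = (N : ℤ) • (fun i => w i / (N : ℤ)) := by
  funext i
  simp only [Pi.smul_apply, smul_eq_mul]
  exact (Int.mul_ediv_cancel' (hw i)).symm

/-- In the period box `[0,N)^d` the only point of the corner class of `0` is `0`. [folklore] -/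
theorem eq_zero_of_mem_periodBox_of_dvd {N : ℕ} {w : Site d} (hw : w ∈ periodBox (d := d) N) (hdvd : ∀ i, (N : ℤ) ∣ w i) : w = 0 := by
  funext i
  obtain ⟨h0, h1⟩ := mem_periodBox.mp hw i
  exact Int.eq_zero_of_dvd_of_nonneg_of_lt h0 h1 (hdvd i)

/-- The class of `0` is invariant under a period shift of the coarse lattice. [folklore] -/
theorem dvd_add_period_iff {N : ℕ} (w : Site d) (j : Fin d) : (∀ i, (N : ℤ) ∣ (w + (N : ℤ) • e j) i) ↔ ∀ i, (N : ℤ) ∣ w i := by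
  refine forall_congr' fun i => ?_
  simp only [Pi.add_apply, Pi.smul_apply, smul_eq_mul]
  exact dvd_add_left (dvd_mul_right _ _)

/-- The Laplacian `Lρ` of the bump is boundary-free (its support is `[2, M−2]^d`). [folklore] -/
theorem lapRho_boundaryFree {M : ℕ} {ψ : ℤ → ℝ}
    (hψ : ∀ t : ℤ, ψ t = if 2 ≤ t ∧ t ≤ (M : ℤ) - 2 then (((t : ℝ) - 2) * ((M : ℝ) - 2 - t)) ^ 2 else 0)
    {ρ : Site d → ℝ} (hρ : ∀ r, ρ r = ∏ i, ψ (r i)) (r : Site d)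
    (hr : (fun r' : Site d => ∑ ν : Fin d, (2 * ρ r' - ρ (r' - e ν) - ρ (r' + e ν))) r ≠ 0) (i : Fin d) :
    1 ≤ r i ∧ r i ≤ (M : ℤ) - 2 := by
  simp only at hr
  obtain ⟨ν, -, hν⟩ := Finset.exists_ne_zero_of_sum_ne_zero hr
  by_contra hcon
  have hout : ∀ p : Site d, (p i = r i ∨ p i = r i - 1 ∨ p i = r i + 1) → ρ p = 0 := by
    intro p hp
    by_contra hne
    have := rho_support hψ hρ hne i
    omega
  have h1 : ρ r = 0 := hout r (Or.inl rfl)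
  have h2 : ρ (r - e ν) = 0 := hout _ (by
    by_cases h : i = ν
    · subst h; right; left; simp [e_apply]
    · left; simp [e_apply, h])
  have h3 : ρ (r + e ν) = 0 := hout _ (by
    by_cases h : i = ν
    · subst h; right; right; simp [e_apply]
    · left; simp [e_apply, h])
  exact hν (by rw [h1, h2, h3]; ring)

/-- `Σ_{r∈[0,M)^d} ρ(r) ≥ ρ(⌊M∕2⌋·𝟙) > 0` (`M ≥ 8`). [folklore] -/
theorem sum_rho_pos {M : ℕ} (hM : 8 ≤ M) {ψ : ℤ → ℝ}
    (hψ : ∀ t : ℤ, ψ t = if 2 ≤ t ∧ t ≤ (M : ℤ) - 2 then (((t : ℝ) - 2) * ((M : ℝ) - 2 - t)) ^ 2 else 0)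
    {ρ : Site d → ℝ} (hρ : ∀ r, ρ r = ∏ i, ψ (r i)) : 0 < ∑ r ∈ periodBox (d := d) M, ρ r := by
  have hs : (fun _ : Fin d => ((M / 2 : ℕ) : ℤ)) ∈ periodBox (d := d) M :=
    mem_periodBox.mpr fun _ => ⟨by positivity, by exact_mod_cast (Nat.div_lt_self (by omega) (by norm_num) : M / 2 < M)⟩
  exact lt_of_lt_of_le (rho_mid_pos hM hψ hρ) (Finset.single_le_sum (fun r _ => rho_nonneg hψ hρ r) hs)

variable {n : Type*} [Fintype n] [DecidableEq n]

/-- The flat covariant Laplacian of a skew field is skew. [folklore] -/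
theorem covLapSite_flatCfg_mem_skew {mu : Site d → Matrix n n ℂ} (hmus : ∀ y, mu y ∈ skewAdjoint (Matrix n n ℂ)) (y : Site d) :
    covLapSite (flatCfg (d := d) (n := n)) mu y ∈ skewAdjoint (Matrix n n ℂ) := by
  rw [← covDiv_gaugeDir_eq_covLapSite]
  exact covDiv_mem_skewAdjoint isUnitaryCfg_flatCfg (gaugeDir_skew isUnitaryCfg_flatCfg hmus) y

/-- **`Δ_1²h = 0 ⇒ Δ_1h = 0`** for a periodic `h` (`Σ‖Δh‖² = Σ hsR (Δ²h) h = 0`). [folklore] -/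
theorem covLapSite_flatCfg_eq_zero_of_sq {P : ℕ} (hP : 1 ≤ P) {h : Site d → Matrix n n ℂ}
    (hhP : ∀ (y : Site d) (i : Fin d), h (y + (P : ℤ) • e i) = h y)
    (h2 : ∀ y, covLapSite (flatCfg (d := d) (n := n)) (covLapSite (flatCfg (d := d) (n := n)) h) y = 0) :
    ∀ y, covLapSite (flatCfg (d := d) (n := n)) h y = 0 := by
  have hWP : IsPeriodicCfg (flatCfg (d := d) (n := n)) (P : ℤ) := isPeriodicCfg_flatCfg _
  have hΔhP := covLapSite_add_period hWP hhP
  have hsum : ∑ y ∈ periodBox (d := d) P, nhsNormSq (covLapSite (flatCfg (d := d) (n := n)) h y) = 0 := by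
    have e := sum_hsR_covLapSite_comm hP hΔhP hhP
    rw [Finset.sum_congr rfl fun y _ => by rw [h2 y, hsR_zero_left], Finset.sum_const_zero] at e
    simpa only [hsR_self] using e.symm
  intro y
  have hbox : ∀ y ∈ periodBox (d := d) P, covLapSite (flatCfg (d := d) (n := n)) h y = 0 := fun y hy =>
    eq_zero_of_nhsNormSq_eq_zero ((Finset.sum_eq_zero_iff_of_nonneg fun y' _ =>
      nhsNormSq_nonneg (covLapSite (flatCfg (d := d) (n := n)) h y')).mp hsum y hy)
  rw [← apply_wrap_eq hΔhP y]
  exact hbox _ (wrap_mem_periodBox P hP y)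

/-- **`Δ_1h = 0 ⇒ h` IS CONSTANT** for a periodic `h` (`Σ‖D_1h‖² = Σ hsR (Δh) h = 0`, then unit steps). [folklore] -/
theorem const_of_covLapSite_flatCfg_eq_zero {P : ℕ} (hP : 1 ≤ P) {h : Site d → Matrix n n ℂ}
    (hhP : ∀ (y : Site d) (i : Fin d), h (y + (P : ℤ) • e i) = h y)
    (h1 : ∀ y, covLapSite (flatCfg (d := d) (n := n)) h y = 0) (v : Site d) : h v = h 0 := by
  have hWu : IsUnitaryCfg (flatCfg (d := d) (n := n)) := isUnitaryCfg_flatCfg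
  have hWP : IsPeriodicCfg (flatCfg (d := d) (n := n)) (P : ℤ) := isPeriodicCfg_flatCfg _
  have hsum : ∑ y ∈ periodBox (d := d) P, ∑ κ : Fin d, nhsNormSq (gaugeDir (flatCfg (d := d) (n := n)) h y κ) = 0 := by
    rw [sum_nhsNormSq_gaugeDir_eq hP hWu hWP hhP]
    exact Finset.sum_eq_zero fun y _ => by rw [h1 y, hsR_zero_left]
  have hbox : ∀ y ∈ periodBox (d := d) P, ∀ κ : Fin d, gaugeDir (flatCfg (d := d) (n := n)) h y κ = 0 := by
    intro y hy κ
    have e1 := (Finset.sum_eq_zero_iff_of_nonneg fun y' _ =>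
      Finset.sum_nonneg fun ν _ => nhsNormSq_nonneg (gaugeDir (flatCfg (d := d) (n := n)) h y' ν)).1 hsum y hy
    exact eq_zero_of_nhsNormSq_eq_zero ((Finset.sum_eq_zero_iff_of_nonneg fun ν _ =>
      nhsNormSq_nonneg (gaugeDir (flatCfg (d := d) (n := n)) h y ν)).1 e1 κ (Finset.mem_univ κ))
  have hDh : ∀ (y : Site d) (κ : Fin d), gaugeDir (flatCfg (d := d) (n := n)) h y κ = 0 := by
    intro y κ
    have hper := isPeriodicDir_gaugeDir hWP hhP
    have hw := apply_wrap_eq (g := fun y' => gaugeDir (flatCfg (d := d) (n := n)) h y' κ) (fun y' i => hper y' i κ) y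
    rw [← hw]
    exact hbox _ (wrap_mem_periodBox P hP y) κ
  have hstep : ∀ (y : Site d) (κ : Fin d), h (y + (1 : ℤ) • e κ) = h y := by
    intro y κ
    have e1 := hDh y κ
    rw [gaugeDir_flatCfg_eq_neg_dPot, neg_eq_zero] at e1
    simp only [dPot, sub_eq_zero] at e1
    rw [one_smul]; exact e1
  have := periodic_vec hstep 0 v
  rwa [one_smul, zero_add] at this


/-! ## §2 The explicit projection -/

/-- **THE EXPLICIT PROJECTION ONTO THE SPAN OF THE BUMP CLASS'S GENERATORS AT THE FLAT BACKGROUND**: a skew `(N·M)`-periodic field `f` that is `hsR`-orthogonal to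
every skew periodic member of the bump class `T^ρ` (membership characterised by clauses (i)∕(ii) through `hT`) IS `Φ_{LLρ}C₁ + Φ_ρC₂` with `C₁` (skew, `N`-periodic,
vanishing on the corner class of `0`) and `C₂` (skew, `N`-periodic, supported on it) given blockwise by `γ•C₁(w) = Σ_r LLρ(r)•f(M•w + r − s)` off the class and
`γ′•C₂(w) = Σ_r ρ(r)•f(M•w + r − s)` on it (`γ = Σ_r LLρ(r)²`, `γ′ = Σ_r ρ(r)²`; `M ≥ 8`, `N ≥ 1`). [folklore] -/
theorem bump_projection_flatCfg {M N : ℕ} (hM : 8 ≤ M) (hN : 1 ≤ N) {ψ : ℤ → ℝ}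
    (hψ : ∀ t : ℤ, ψ t = if 2 ≤ t ∧ t ≤ (M : ℤ) - 2 then (((t : ℝ) - 2) * ((M : ℝ) - 2 - t)) ^ 2 else 0)
    {ρ : Site d → ℝ} (hρ : ∀ r, ρ r = ∏ i, ψ (r i)) {s : Site d} (hs : s = fun _ => ((M / 2 : ℕ) : ℤ))
    {Lρ : Site d → ℝ} (hLρ : Lρ = fun r => ∑ ν : Fin d, (2 * ρ r - ρ (r - e ν) - ρ (r + e ν)))
    {LLρ : Site d → ℝ} (hLLρ : LLρ = fun r => ∑ ν : Fin d, (2 * Lρ r - Lρ (r - e ν) - Lρ (r + e ν)))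
    (T : (Site d → Matrix n n ℂ) → Prop)
    (hT : ∀ nu : Site d → Matrix n n ℂ, T nu ↔
      ((∀ C : Site d → Matrix n n ℂ, (∀ w, C w ∈ skewAdjoint (Matrix n n ℂ)) → (∀ (w : Site d) (i : Fin d), C (w + (N : ℤ) • e i) = C w) →
          (∀ w : Site d, C ((N : ℤ) • w) = 0) →
          ∑ y ∈ periodBox (d := d) (N * M), hsR ((fun x => ρ (res M (x + s)) • C (blk M (x + s))) y)
            (covLapSite (flatCfg (d := d) (n := n)) (covLapSite (flatCfg (d := d) (n := n)) nu) y) = 0) ∧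
       (∀ C : Site d → Matrix n n ℂ, (∀ w, C w ∈ skewAdjoint (Matrix n n ℂ)) → (∀ (w : Site d) (i : Fin d), C (w + (N : ℤ) • e i) = C w) →
          (∀ w : Site d, (¬ ∀ i, (N : ℤ) ∣ w i) → C w = 0) →
          ∑ y ∈ periodBox (d := d) (N * M), hsR ((fun x => ρ (res M (x + s)) • C (blk M (x + s))) y) (nu y) = 0)))
    {f : Site d → Matrix n n ℂ} (hfs : ∀ y, f y ∈ skewAdjoint (Matrix n n ℂ)) (hfP : ∀ (y : Site d) (i : Fin d), f (y + ((N * M : ℕ) : ℤ) • e i) = f y)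
    (hforth : ∀ nu : Site d → Matrix n n ℂ, (∀ y, nu y ∈ skewAdjoint (Matrix n n ℂ)) →
        (∀ (y : Site d) (i : Fin d), nu (y + ((N * M : ℕ) : ℤ) • e i) = nu y) → T nu →
      ∑ y ∈ periodBox (d := d) (N * M), hsR (f y) (nu y) = 0) :
    ∃ C₁ C₂ : Site d → Matrix n n ℂ,
      (∀ w, C₁ w ∈ skewAdjoint (Matrix n n ℂ)) ∧ (∀ (w : Site d) (i : Fin d), C₁ (w + (N : ℤ) • e i) = C₁ w) ∧ (∀ w : Site d, C₁ ((N : ℤ) • w) = 0) ∧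
      (∀ w, C₂ w ∈ skewAdjoint (Matrix n n ℂ)) ∧ (∀ (w : Site d) (i : Fin d), C₂ (w + (N : ℤ) • e i) = C₂ w) ∧
      (∀ w : Site d, (¬ ∀ i, (N : ℤ) ∣ w i) → C₂ w = 0) ∧
      (∀ y, f y = (fun x => LLρ (res M (x + s)) • C₁ (blk M (x + s))) y + (fun x => ρ (res M (x + s)) • C₂ (blk M (x + s))) y) ∧
      (∀ w : Site d, (¬ ∀ i, (N : ℤ) ∣ w i) →
        (∑ r ∈ periodBox (d := d) M, LLρ r * LLρ r) • C₁ w = ∑ r ∈ periodBox (d := d) M, LLρ r • f ((M : ℤ) • w + r - s)) ∧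
      (∀ w : Site d, (∀ i, (N : ℤ) ∣ w i) →
        (∑ r ∈ periodBox (d := d) M, ρ r * ρ r) • C₂ w = ∑ r ∈ periodBox (d := d) M, ρ r • f ((M : ℤ) • w + r - s)) := by
  classical
  have hM1 : 1 ≤ M := by omega
  have hP : 1 ≤ N * M := Nat.mul_pos (by omega) (by omega)
  have hWu : IsUnitaryCfg (flatCfg (d := d) (n := n)) := isUnitaryCfg_flatCfg
  have hWP : IsPeriodicCfg (flatCfg (d := d) (n := n)) ((N * M : ℕ) : ℤ) := isPeriodicCfg_flatCfg _
  have hρs : 0 < ρ s := by rw [hs]; exact rho_mid_pos hM hψ hρ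
  have hs0 : ∀ i, 0 ≤ s i := fun i => by simp only [hs]; positivity
  have hs1 : ∀ i, s i < M := fun i => by
    simp only [hs]; exact_mod_cast (Nat.div_lt_self (by omega) (by norm_num) : M / 2 < M)
  -- notation: `Δ := Δ_1`, the two profiles `Lρ`, `LLρ`
  set Δ : (Site d → Matrix n n ℂ) → Site d → Matrix n n ℂ := covLapSite (flatCfg (d := d) (n := n)) with hΔ
  have hρbf : ∀ r : Site d, ρ r ≠ 0 → ∀ i, 1 ≤ r i ∧ r i ≤ (M : ℤ) - 2 := rho_boundaryFree hψ hρ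
  have hLρbf : ∀ r : Site d, Lρ r ≠ 0 → ∀ i, 1 ≤ r i ∧ r i ≤ (M : ℤ) - 2 := fun r hr => by
    subst hLρ; exact lapRho_boundaryFree hψ hρ r hr
  -- the blockwise Laplacians of the profile fields (F95)
  have hΔρ : ∀ C : Site d → Matrix n n ℂ, Δ (fun x => ρ (res M (x + s)) • C (blk M (x + s))) = fun x => Lρ (res M (x + s)) • C (blk M (x + s)) :=
    fun C => funext fun y => by rw [hLρ]; exact covLapSite_flatCfg_profS hM1 s hρbf C y
  have hΔLρ : ∀ C : Site d → Matrix n n ℂ, Δ (fun x => Lρ (res M (x + s)) • C (blk M (x + s))) = fun x => LLρ (res M (x + s)) • C (blk M (x + s)) :=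
    fun C => funext fun y => by rw [hLLρ]; exact covLapSite_flatCfg_profS hM1 s hLρbf C y
  -- periodicity / skewness bookkeeping
  have hperΔ : ∀ {g : Site d → Matrix n n ℂ}, (∀ (y : Site d) (i : Fin d), g (y + ((N * M : ℕ) : ℤ) • e i) = g y) →
      ∀ (y : Site d) (i : Fin d), Δ g (y + ((N * M : ℕ) : ℤ) • e i) = Δ g y := fun hg => covLapSite_add_period hWP hg
  have hperΦ : ∀ (g : Site d → ℝ) {C : Site d → Matrix n n ℂ}, (∀ (w : Site d) (i : Fin d), C (w + (N : ℤ) • e i) = C w) →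
      ∀ (y : Site d) (i : Fin d), (fun x => g (res M (x + s)) • C (blk M (x + s))) (y + ((N * M : ℕ) : ℤ) • e i)
        = (fun x => g (res M (x + s)) • C (blk M (x + s))) y := fun g C hC => profS_add_period hM1 s g hC
  have hfP' : ∀ (y : Site d) (i : Fin d), f (y + ((M : ℤ) * (N : ℤ)) • e i) = f y := fun y i => by
    have := hfP y i; push_cast at this; rw [mul_comm] at this; exact this
  -- the block sums of `f` against the two profiles, and the Gram constants
  set S : Site d → Matrix n n ℂ := fun w => ∑ r ∈ periodBox (d := d) M, LLρ r • f ((M : ℤ) • w + r - s) with hS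
  set S' : Site d → Matrix n n ℂ := fun w => ∑ r ∈ periodBox (d := d) M, ρ r • f ((M : ℤ) • w + r - s) with hS'
  set γ : ℝ := ∑ r ∈ periodBox (d := d) M, LLρ r * LLρ r with hγ
  set γ' : ℝ := ∑ r ∈ periodBox (d := d) M, ρ r * ρ r with hγ'
  have hblockP : ∀ (g : Site d → ℝ) (w : Site d) (i : Fin d),
      (∑ r ∈ periodBox (d := d) M, g r • f ((M : ℤ) • (w + (N : ℤ) • e i) + r - s)) = ∑ r ∈ periodBox (d := d) M, g r • f ((M : ℤ) • w + r - s) := by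
    intro g w i
    refine Finset.sum_congr rfl fun r _ => ?_
    have e1 : (M : ℤ) • (w + (N : ℤ) • e i) + r - s = ((M : ℤ) • w + r - s) + ((M : ℤ) * (N : ℤ)) • e i := by
      rw [smul_add, smul_smul]; abel
    rw [e1, hfP']
  have hSP : ∀ (w : Site d) (i : Fin d), S (w + (N : ℤ) • e i) = S w := fun w i => hblockP LLρ w i
  have hS'P : ∀ (w : Site d) (i : Fin d), S' (w + (N : ℤ) • e i) = S' w := fun w i => hblockP ρ w i
  have hSs : ∀ w, S w ∈ skewAdjoint (Matrix n n ℂ) := fun w => (skewAdjoint _).sum_mem fun r _ => skewAdjoint.smul_mem _ (hfs _)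
  have hS's : ∀ w, S' w ∈ skewAdjoint (Matrix n n ℂ) := fun w => (skewAdjoint _).sum_mem fun r _ => skewAdjoint.smul_mem _ (hfs _)
  have hγ'0 : 0 < γ' := by
    have hsmem : s ∈ periodBox (d := d) M := mem_periodBox.mpr fun i => ⟨hs0 i, hs1 i⟩
    exact lt_of_lt_of_le (mul_pos hρs hρs) (Finset.single_le_sum (fun r _ => mul_self_nonneg (ρ r)) hsmem)
  -- `γ·γ⁻¹·S = S` (if `γ = 0` then `LLρ = 0` on the box and `S = 0`)
  have hγS : ∀ w, (γ * γ⁻¹) • S w = S w := by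
    intro w
    rcases eq_or_ne γ 0 with h0 | h0
    · have hz : ∀ r ∈ periodBox (d := d) M, LLρ r = 0 := fun r hr =>
        mul_self_eq_zero.mp ((Finset.sum_eq_zero_iff_of_nonneg fun r' _ => mul_self_nonneg (LLρ r')).mp h0 r hr)
      have hS0 : S w = 0 := Finset.sum_eq_zero fun r hr => by rw [hz r hr, zero_smul]
      rw [hS0, smul_zero]
    · rw [mul_inv_cancel₀ h0, one_smul]
  -- the projection data: `C₁ := γ⁻¹S` off the class of `0`, `C₂ := γ′⁻¹S′` on it
  set C₁ : Site d → Matrix n n ℂ := fun w => if (∀ i, (N : ℤ) ∣ w i) then 0 else γ⁻¹ • S w with hC₁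
  set C₂ : Site d → Matrix n n ℂ := fun w => if (∀ i, (N : ℤ) ∣ w i) then γ'⁻¹ • S' w else 0 with hC₂
  have hC₁s : ∀ w, C₁ w ∈ skewAdjoint (Matrix n n ℂ) := fun w => by
    simp only [hC₁]; split_ifs
    · exact (skewAdjoint _).zero_mem
    · exact skewAdjoint.smul_mem _ (hSs _)
  have hC₂s : ∀ w, C₂ w ∈ skewAdjoint (Matrix n n ℂ) := fun w => by
    simp only [hC₂]; split_ifs
    · exact skewAdjoint.smul_mem _ (hS's _)
    · exact (skewAdjoint _).zero_mem
  have hC₁P : ∀ (w : Site d) (i : Fin d), C₁ (w + (N : ℤ) • e i) = C₁ w := fun w i => by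
    simp only [hC₁, dvd_add_period_iff w i, hSP]
  have hC₂P : ∀ (w : Site d) (i : Fin d), C₂ (w + (N : ℤ) • e i) = C₂ w := fun w i => by
    simp only [hC₂, dvd_add_period_iff w i, hS'P]
  have hC₁0 : ∀ w : Site d, C₁ ((N : ℤ) • w) = 0 := fun w => by
    simp only [hC₁]; rw [if_pos]; intro i; simp only [Pi.smul_apply, smul_eq_mul]; exact dvd_mul_right _ _
  have hC₂0 : ∀ w : Site d, (¬ ∀ i, (N : ℤ) ∣ w i) → C₂ w = 0 := fun w hw => by simp only [hC₂, if_neg hw]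
  -- pointwise pairings with admissible data
  have hpair₁ : ∀ C : Site d → Matrix n n ℂ, (∀ w : Site d, C ((N : ℤ) • w) = 0) → ∀ w, γ * hsR (C w) (C₁ w) = hsR (C w) (S w) := by
    intro C hC0 w
    by_cases hw : ∀ i, (N : ℤ) ∣ w i
    · have hCw : C w = 0 := by rw [eq_smul_ediv_of_dvd hw]; exact hC0 _
      simp only [hCw, hsR_zero_left, mul_zero]
    · simp only [hC₁, if_neg hw]
      rw [← hsR_smul_right, smul_smul, hγS]
  have hpair₂ : ∀ C : Site d → Matrix n n ℂ, (∀ w : Site d, (¬ ∀ i, (N : ℤ) ∣ w i) → C w = 0) → ∀ w, γ' * hsR (C w) (C₂ w) = hsR (C w) (S' w) := by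
    intro C hC0 w
    by_cases hw : ∀ i, (N : ℤ) ∣ w i
    · simp only [hC₂, if_pos hw]
      rw [← hsR_smul_right, smul_smul, mul_inv_cancel₀ hγ'0.ne', one_smul]
    · simp only [hC0 w hw, hsR_zero_left, mul_zero]
  have hdisj₁₂ : ∀ C : Site d → Matrix n n ℂ, (∀ w : Site d, C ((N : ℤ) • w) = 0) → ∀ w, hsR (C w) (C₂ w) = 0 := by
    intro C hC0 w
    by_cases hw : ∀ i, (N : ℤ) ∣ w i
    · have hCw : C w = 0 := by rw [eq_smul_ediv_of_dvd hw]; exact hC0 _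
      rw [hCw, hsR_zero_left]
    · rw [hC₂0 w hw, hsR_zero_right]
  have hdisj₂₁ : ∀ C : Site d → Matrix n n ℂ, (∀ w : Site d, (¬ ∀ i, (N : ℤ) ∣ w i) → C w = 0) → ∀ w, hsR (C w) (C₁ w) = 0 := by
    intro C hC0 w
    by_cases hw : ∀ i, (N : ℤ) ∣ w i
    · simp only [hC₁, if_pos hw, hsR_zero_right]
    · rw [hC0 w hw, hsR_zero_left]
  -- the two profile fields of the projection and the residual `ν`
  set Φ₁ : Site d → Matrix n n ℂ := fun x => LLρ (res M (x + s)) • C₁ (blk M (x + s)) with hΦ₁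
  set Φ₂ : Site d → Matrix n n ℂ := fun x => ρ (res M (x + s)) • C₂ (blk M (x + s)) with hΦ₂
  have hΦ₁P : ∀ (y : Site d) (i : Fin d), Φ₁ (y + ((N * M : ℕ) : ℤ) • e i) = Φ₁ y := hperΦ LLρ hC₁P
  have hΦ₂P : ∀ (y : Site d) (i : Fin d), Φ₂ (y + ((N * M : ℕ) : ℤ) • e i) = Φ₂ y := hperΦ ρ hC₂P
  set nu : Site d → Matrix n n ℂ := fun y => f y - (Φ₁ y + Φ₂ y) with hnu
  have hnus : ∀ y, nu y ∈ skewAdjoint (Matrix n n ℂ) := fun y =>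
    (skewAdjoint _).sub_mem (hfs y) ((skewAdjoint _).add_mem (profS_mem_skew M s LLρ hC₁s y) (profS_mem_skew M s ρ hC₂s y))
  have hnuP : ∀ (y : Site d) (i : Fin d), nu (y + ((N * M : ℕ) : ℤ) • e i) = nu y := fun y i => by
    simp only [hnu, hfP y i, hΦ₁P y i, hΦ₂P y i]
  -- block pairings of a profile field with `f`, `Φ₁`, `Φ₂`
  have pair_f : ∀ (g : Site d → ℝ) {C : Site d → Matrix n n ℂ}, (∀ (w : Site d) (i : Fin d), C (w + (N : ℤ) • e i) = C w) →
      ∑ y ∈ periodBox (d := d) (N * M), hsR ((fun x => g (res M (x + s)) • C (blk M (x + s))) y) (f y)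
        = ∑ w ∈ periodBox (d := d) N, hsR (C w) (∑ r ∈ periodBox (d := d) M, g r • f ((M : ℤ) • w + r - s)) :=
    fun g C hC => sum_hsR_profS hM1 hN s g C hfP hC
  have pair_pp : ∀ (g h : Site d → ℝ) {C C' : Site d → Matrix n n ℂ}, (∀ (w : Site d) (i : Fin d), C (w + (N : ℤ) • e i) = C w) →
      (∀ (w : Site d) (i : Fin d), C' (w + (N : ℤ) • e i) = C' w) →
      ∑ y ∈ periodBox (d := d) (N * M), hsR ((fun x => g (res M (x + s)) • C (blk M (x + s))) y) ((fun x => h (res M (x + s)) • C' (blk M (x + s))) y)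
        = (∑ r ∈ periodBox (d := d) M, g r * h r) * ∑ w ∈ periodBox (d := d) N, hsR (C w) (C' w) :=
    fun g h C C' hC hC' => sum_hsR_profS_profS hM1 hN s g h hC hC'
  -- STEP A (1): `ν ∈ T^ρ`
  have hTnu : T nu := by
    rw [hT]
    constructor
    · -- clause (i): move `Δ²` onto the profile field, then the block pairings
      intro C hCs hCP hC0
      have hΦP := hperΦ ρ hCP
      have hΔΦP := hperΔ (g := fun x => ρ (res M (x + s)) • C (blk M (x + s))) hΦP
      have hmove : ∑ y ∈ periodBox (d := d) (N * M), hsR ((fun x => ρ (res M (x + s)) • C (blk M (x + s))) y) (Δ (Δ nu) y)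
          = ∑ y ∈ periodBox (d := d) (N * M), hsR ((fun x => LLρ (res M (x + s)) • C (blk M (x + s))) y) (nu y) := by
        rw [← sum_hsR_covLapSite_comm hP hΦP (hperΔ hnuP), ← sum_hsR_covLapSite_comm hP hΔΦP hnuP]
        simp only [hΔ] at hΔρ hΔLρ ⊢
        rw [hΔρ C, hΔLρ C]
      rw [hmove]
      simp only [hnu, hsR_sub_right, hsR_add_right, Finset.sum_sub_distrib, Finset.sum_add_distrib]
      have e1 := pair_f LLρ hCP
      have e2 := pair_pp LLρ LLρ hCP hC₁P
      have e3 := pair_pp LLρ ρ hCP hC₂P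
      simp only at e1 e2 e3
      simp only [hΦ₁, hΦ₂]
      rw [e1, e2, e3]
      rw [Finset.sum_congr rfl fun w _ => hdisj₁₂ C hC0 w, Finset.sum_const_zero, mul_zero, add_zero, ← hγ, Finset.mul_sum]
      rw [Finset.sum_congr rfl fun w _ => hpair₁ C hC0 w, sub_self]
    · -- clause (ii)
      intro C hCs hCP hC0
      simp only [hnu, hsR_sub_right, hsR_add_right, Finset.sum_sub_distrib, Finset.sum_add_distrib]
      have e1 := pair_f ρ hCP
      have e2 := pair_pp ρ LLρ hCP hC₁P
      have e3 := pair_pp ρ ρ hCP hC₂P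
      simp only at e1 e2 e3
      simp only [hΦ₁, hΦ₂]
      rw [e1, e2, e3]
      rw [Finset.sum_congr rfl fun w _ => hdisj₂₁ C hC0 w, Finset.sum_const_zero, mul_zero, zero_add, ← hγ', Finset.mul_sum]
      rw [Finset.sum_congr rfl fun w _ => hpair₂ C hC0 w, sub_self]
  obtain ⟨hTi, hTii⟩ := (hT nu).mp hTnu
  -- STEP A (2): `⟨f, ν⟩ = 0` (the hypothesis, moved through `Δ²`) and `⟨Φ₁ + Φ₂, ν⟩ = 0` (the clauses for `ν` itself)
  have hfnu : ∑ y ∈ periodBox (d := d) (N * M), hsR (f y) (nu y) = 0 := hforth nu hnus hnuP hTnu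
  have hΦ₁nu : ∑ y ∈ periodBox (d := d) (N * M), hsR (Φ₁ y) (nu y) = 0 := by
    have hΦP := hperΦ ρ hC₁P
    have hΔΦP := hperΔ (g := fun x => ρ (res M (x + s)) • C₁ (blk M (x + s))) hΦP
    have h1 := hTi C₁ hC₁s hC₁P hC₁0
    rw [← sum_hsR_covLapSite_comm hP hΦP (hperΔ hnuP), ← sum_hsR_covLapSite_comm hP hΔΦP hnuP] at h1
    simp only [hΔ] at hΔρ hΔLρ h1
    rw [hΔρ C₁, hΔLρ C₁] at h1
    simpa only [hΦ₁] using h1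
  have hΦ₂nu : ∑ y ∈ periodBox (d := d) (N * M), hsR (Φ₂ y) (nu y) = 0 := by
    simpa only [hΦ₂] using hTii C₂ hC₂s hC₂P hC₂0
  -- hence `ν = 0`, i.e. `f = Φ₁ + Φ₂`
  have hnunu : ∑ y ∈ periodBox (d := d) (N * M), nhsNormSq (nu y) = 0 := by
    have h : ∑ y ∈ periodBox (d := d) (N * M), hsR (nu y) (nu y) = 0 := by
      have e : ∀ y, hsR (nu y) (nu y) = hsR (f y) (nu y) - (hsR (Φ₁ y) (nu y) + hsR (Φ₂ y) (nu y)) := fun y => by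
        rw [hnu]; simp only; rw [hsR_sub_left, hsR_add_left]
      simp_rw [e]
      rw [Finset.sum_sub_distrib, Finset.sum_add_distrib, hfnu, hΦ₁nu, hΦ₂nu]; ring
    simpa only [hsR_self] using h
  have hnu0 : ∀ y, nu y = 0 := by
    intro y
    have hbox : ∀ y ∈ periodBox (d := d) (N * M), nu y = 0 := fun y hy =>
      eq_zero_of_nhsNormSq_eq_zero ((Finset.sum_eq_zero_iff_of_nonneg fun y' _ => nhsNormSq_nonneg (nu y')).mp hnunu y hy)
    rw [← apply_wrap_eq hnuP y]
    exact hbox _ (wrap_mem_periodBox (N * M) hP y)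
  have hfk : ∀ y, f y = Φ₁ y + Φ₂ y := fun y => sub_eq_zero.mp (hnu0 y)
  refine ⟨C₁, C₂, hC₁s, hC₁P, hC₁0, hC₂s, hC₂P, hC₂0, fun y => by simpa only [hΦ₁, hΦ₂] using hfk y, fun w hw => ?_, fun w hw => ?_⟩
  · show γ • C₁ w = S w
    simp only [hC₁, if_neg hw, smul_smul, hγS]
  · show γ' • C₂ w = S' w
    simp only [hC₂, if_pos hw, smul_smul, mul_inv_cancel₀ hγ'0.ne', one_smul]

end

end Summit.QuantumFields.BalabanUV.T4Continuum.NE7CornerBumpFlatProjection
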